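import Mathlib
import HarnessLib
import Summits.FinalStateConjecture.Statement
import Literature.Geometry.Lorentzian.LandauLifshitzPseudotensor
import Literature.MathematicalPhysics.KineticTheory.DuhamelSliceFormula

/-!
# Route EIHFluxBalance — `InertialRecession`, line `sublinear-is-free-clean-window-charges`:
# `C¹` paths shadowing Lipschitz window paths (helper for `stub_chargeModel`)

Helper file (`--supports stmt-FinalStateConjecture-10166`) for the crux
`Summit.FinalStateConjecture.FinalStateConjecture.Theses.EIHFluxBalance.InertialRecession`.

The WINDOW LAW of the line is stated for 2-Lipschitz paths of window spheres `(c, R)` on `[t₁, t₂]`,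
while the moving-sphere law `stub_windowCharges` (WCH′) wants `C¹` paths with `‖ċ‖, |Ṙ| ≤ 2`. The
bridge is the BACKWARD MOVING AVERAGE of the clamped path,
`ĉ(s) = η⁻¹ ∫_{s−η}^{s} c(clamp u) du`: it is `C¹` with `‖ĉ′‖ ≤ L` (same Lipschitz constant), it
starts exactly at `c(t₁)` at time `t₁`, ends exactly at `c(t₂)` at time `t₂ + η`, and stays within
`Lη` of the clamped path — so WCH′ applied on `[t₁, t₂ + η]` to `(ĉ, R̂)` and on `[t₂, t₂ + η]` to the
static sphere `(c(t₂), R(t₂))` compares the charges at the ORIGINAL endpoints, with no continuity of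
the charges in the sphere needed (`exists_contDiff_shadow_of_lipschitzOn`).
-/

set_option linter.dupNamespace false

noncomputable section

open Set Filter MeasureTheory intervalIntegral
open scoped Topology

namespace Summit.FinalStateConjecture.FinalStateConjecture.Theorems

namespace WindowPaths

variable {F : Type*} [NormedAddCommGroup F] [NormedSpace ℝ F] [CompleteSpace F]

/-- The clamp `u ↦ max t₁ (min u t₂)` is `1`-Lipschitz. [folklore] -/
theorem abs_clamp_sub_clamp_le (t₁ t₂ u v : ℝ) :
    |max t₁ (min u t₂) - max t₁ (min v t₂)| ≤ |u - v| := by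
  calc |max t₁ (min u t₂) - max t₁ (min v t₂)| ≤ max |t₁ - t₁| |min u t₂ - min v t₂| :=
        abs_max_sub_max_le_max _ _ _ _
    _ = |min u t₂ - min v t₂| := by rw [sub_self, abs_zero, max_eq_right (abs_nonneg _)]
    _ ≤ max |u - v| |t₂ - t₂| := abs_min_sub_min_le_max _ _ _ _
    _ = |u - v| := by rw [sub_self, abs_zero, max_eq_left (abs_nonneg _)]

/-- The clamp takes values in `[t₁, t₂]` (`t₁ ≤ t₂`). [folklore] -/
@[deprecated Literature.MathematicalPhysics.KineticTheory.clamp_mem (since := "2026-08-17")]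
alias clamp_mem_Icc := Literature.MathematicalPhysics.KineticTheory.clamp_mem

/-- **A `C¹` shadow of a Lipschitz path.** Let `c` be `L`-Lipschitz on `[t₁, t₂]` (`t₁ ≤ t₂`, `0 ≤ L`)
and `η > 0`. Then there is a `C¹` path `ĉ : ℝ → F` with `‖ĉ′‖ ≤ L` everywhere, `ĉ(t₁) = c(t₁)`,
`ĉ(t₂ + η) = c(t₂)`, and `‖ĉ(s) − c(clamp s)‖ ≤ L η` for all `s` (clamp to `[t₁, t₂]`); in particular
`‖ĉ(s) − c(s)‖ ≤ Lη` on `[t₁, t₂]` and `‖ĉ(s) − c(t₂)‖ ≤ Lη` for `s ≥ t₂`. Construction: the backward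
moving average `ĉ(s) = η⁻¹ ∫_{s−η}^{s} c(clamp u) du` (fundamental theorem of calculus for the
continuous clamped path). [folklore] -/
theorem exists_contDiff_shadow_of_lipschitzOn {c : ℝ → F} {t₁ t₂ L : ℝ} (ht : t₁ ≤ t₂) (hL : 0 ≤ L)
    (hc : ∀ s ∈ Icc t₁ t₂, ∀ s' ∈ Icc t₁ t₂, ‖c s - c s'‖ ≤ L * |s - s'|) {η : ℝ} (hη : 0 < η) :
    ∃ ĉ : ℝ → F, ContDiff ℝ 1 ĉ ∧ (∀ s, ‖deriv ĉ s‖ ≤ L) ∧ ĉ t₁ = c t₁ ∧ ĉ (t₂ + η) = c t₂ ∧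
      ∀ s, ‖ĉ s - c (max t₁ (min s t₂))‖ ≤ L * η := by
  -- the clamped path: continuous and `L`-Lipschitz on `ℝ`
  set cb : ℝ → F := fun u ↦ c (max t₁ (min u t₂)) with hcb
  have hlip : ∀ u v, ‖cb u - cb v‖ ≤ L * |u - v| := fun u v ↦
    (hc _ (Literature.MathematicalPhysics.KineticTheory.clamp_mem ht u) _ (Literature.MathematicalPhysics.KineticTheory.clamp_mem ht v)).trans
      (mul_le_mul_of_nonneg_left (abs_clamp_sub_clamp_le t₁ t₂ u v) hL)
  have hcont : Continuous cb := by
    refine continuous_iff_continuousAt.2 fun u ↦ ?_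
    refine (continuousAt_iff_continuous_left_right.2 ⟨?_, ?_⟩) <;>
    · refine Metric.continuousWithinAt_iff.2 fun ε hε ↦ ⟨ε / (L + 1), by positivity, fun v _ hv ↦ ?_⟩
      rw [dist_eq_norm]
      rw [Real.dist_eq] at hv
      calc ‖cb v - cb u‖ ≤ L * |v - u| := hlip v u
        _ ≤ (L + 1) * |v - u| := by gcongr; linarith
        _ < (L + 1) * (ε / (L + 1)) := by gcongr
        _ = ε := by field_simp
  -- the primitive and the moving average
  set Fp : ℝ → F := fun u ↦ ∫ x in (0 : ℝ)..u, cb x with hFp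
  have hFd : ∀ u, HasDerivAt Fp (cb u) u := fun u ↦
    (hcont.integral_hasStrictDerivAt 0 u).hasDerivAt
  set ĉ : ℝ → F := fun s ↦ η⁻¹ • (Fp s - Fp (s - η)) with hĉ
  have hĉ_int : ∀ s, ĉ s = η⁻¹ • ∫ x in (s - η)..s, cb x := by
    intro s
    rw [hĉ]
    simp only
    rw [hFp, integral_interval_sub_left (hcont.intervalIntegrable _ _) (hcont.intervalIntegrable _ _)]
  have hderiv : ∀ s, HasDerivAt ĉ (η⁻¹ • (cb s - cb (s - η))) s := by
    intro s
    have h1 : HasDerivAt (fun s ↦ Fp (s - η)) (cb (s - η)) s := by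
      have := (hFd (s - η)).scomp s ((hasDerivAt_id s).sub_const η)
      simp only [id_eq, one_smul] at this
      exact this
    exact ((hFd s).sub h1).const_smul η⁻¹
  have hderiv_eq : deriv ĉ = fun s ↦ η⁻¹ • (cb s - cb (s - η)) := funext fun s ↦ (hderiv s).deriv
  have hdiff : Differentiable ℝ ĉ := fun s ↦ (hderiv s).differentiableAt
  refine ⟨ĉ, ?_, ?_, ?_, ?_, ?_⟩
  · -- `C¹`
    rw [contDiff_one_iff_deriv]
    refine ⟨hdiff, ?_⟩
    rw [hderiv_eq]
    exact (hcont.sub (hcont.comp (continuous_id.sub continuous_const))).const_smul _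
  · -- derivative bound
    intro s
    rw [hderiv_eq]
    simp only
    rw [norm_smul, norm_inv, Real.norm_eq_abs, abs_of_pos hη]
    calc η⁻¹ * ‖cb s - cb (s - η)‖ ≤ η⁻¹ * (L * |s - (s - η)|) :=
          mul_le_mul_of_nonneg_left (hlip _ _) (by positivity)
      _ = L := by
          rw [show s - (s - η) = η by ring, abs_of_pos hη]
          field_simp
  · -- start point
    rw [hĉ_int]
    have hconst : ∫ x in (t₁ - η)..t₁, cb x = ∫ x in (t₁ - η)..t₁, c t₁ := by
      refine integral_congr fun x hx ↦ ?_
      rw [uIcc_of_le (by linarith)] at hx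
      simp only [hcb]
      rw [min_eq_left (hx.2.trans ht), max_eq_left hx.2]
    rw [hconst, intervalIntegral.integral_const, show t₁ - (t₁ - η) = η by ring, smul_smul,
      inv_mul_cancel₀ hη.ne', one_smul]
  · -- end point
    rw [hĉ_int]
    have hconst : ∫ x in (t₂ + η - η)..(t₂ + η), cb x = ∫ x in (t₂ + η - η)..(t₂ + η), c t₂ := by
      refine integral_congr fun x hx ↦ ?_
      rw [uIcc_of_le (by linarith)] at hx
      simp only [hcb]
      have hx1 : t₂ ≤ x := by linarith [hx.1]
      rw [min_eq_right hx1, max_eq_right ht]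
    rw [hconst, intervalIntegral.integral_const, show t₂ + η - (t₂ + η - η) = η by ring, smul_smul,
      inv_mul_cancel₀ hη.ne', one_smul]
  · -- uniform closeness to the clamped path
    intro s
    rw [hĉ_int]
    have hcs : cb s = η⁻¹ • ∫ _ in (s - η)..s, cb s := by
      rw [intervalIntegral.integral_const, show s - (s - η) = η by ring, smul_smul, inv_mul_cancel₀ hη.ne',
        one_smul]
    rw [show c (max t₁ (min s t₂)) = cb s from rfl, hcs, ← smul_sub,
      ← integral_sub (hcont.intervalIntegrable _ _) intervalIntegrable_const, norm_smul, norm_inv,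
      Real.norm_eq_abs, abs_of_pos hη]
    have hbound : ‖∫ x in (s - η)..s, (cb x - cb s)‖ ≤ (L * η) * |s - (s - η)| := by
      refine norm_integral_le_of_norm_le_const fun x hx ↦ ?_
      rw [uIoc_of_le (by linarith)] at hx
      calc ‖cb x - cb s‖ ≤ L * |x - s| := hlip x s
        _ ≤ L * η := by
            refine mul_le_mul_of_nonneg_left ?_ hL
            rw [abs_le]
            constructor <;> linarith [hx.1, hx.2]
    rw [show s - (s - η) = η by ring, abs_of_pos hη] at hbound
    calc η⁻¹ * ‖∫ x in (s - η)..s, (cb x - cb s)‖ ≤ η⁻¹ * (L * η * η) :=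
          mul_le_mul_of_nonneg_left hbound (by positivity)
      _ = L * η := by field_simp

/-- **Local infimum of a threshold tending to infinity.** For `ρ : ℝ → ℝ` with `ρ → ∞` there is
`ρ' : ℝ → ℝ` with `ρ' → ∞` and `ρ'(s) ≤ ρ(s')` whenever `|s' − s| ≤ 1` and `s` is large: the law's
threshold may be replaced by one that is insensitive to shifting the window by `≤ 1` in time. [folklore] -/
theorem exists_local_lower_threshold {ρ : ℝ → ℝ} (hρ : Tendsto ρ atTop atTop) :
    ∃ ρ' : ℝ → ℝ, Tendsto ρ' atTop atTop ∧ ∃ T : ℝ, ∀ s, T ≤ s → ∀ s', |s' - s| ≤ 1 → ρ' s ≤ ρ s' := by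
  -- `ρ' s = sInf (ρ '' [s-1, s+1])`, well behaved once `ρ ≥ 0` on `[s-1, ∞)`
  obtain ⟨T₀, hT₀⟩ := (tendsto_atTop_atTop.1 hρ) 0
  refine ⟨fun s ↦ sInf (ρ '' Icc (s - 1) (s + 1)), ?_, T₀ + 1, ?_⟩
  · rw [tendsto_atTop_atTop]
    intro b
    obtain ⟨T₁, hT₁⟩ := (tendsto_atTop_atTop.1 hρ) b
    refine ⟨T₁ + 1, fun s hs ↦ ?_⟩
    refine le_csInf ((nonempty_Icc.2 (by linarith)).image ρ) ?_
    rintro _ ⟨u, hu, rfl⟩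
    exact hT₁ u (by linarith [hu.1])
  · intro s hs s' hs'
    have hbdd : BddBelow (ρ '' Icc (s - 1) (s + 1)) := ⟨0, by
      rintro _ ⟨u, hu, rfl⟩
      exact hT₀ u (by linarith [hu.1])⟩
    refine csInf_le hbdd ⟨s', ?_, rfl⟩
    rw [abs_le] at hs'
    constructor <;> linarith [hs'.1, hs'.2]

end WindowPaths

/-- Registered sub-goal form (stub `exists_contDiff_shadow_of_lipschitzOn_Icc` of the crux item) of
`WindowPaths.exists_contDiff_shadow_of_lipschitzOn`: a `C¹` path with the same speed bound shadowing a
Lipschitz window path, pinned to its endpoints at times `t₁` and `t₂ + η`. [folklore] -/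
theorem exists_contDiff_shadow_of_lipschitzOn_Icc : ∀ {F : Type*} [NormedAddCommGroup F] [NormedSpace ℝ F] [CompleteSpace F] {c : ℝ → F} {t₁ t₂ L : ℝ}, t₁ ≤ t₂ → 0 ≤ L → (∀ s ∈ Set.Icc t₁ t₂, ∀ s' ∈ Set.Icc t₁ t₂, ‖c s - c s'‖ ≤ L * |s - s'|) → ∀ {η : ℝ}, 0 < η → ∃ ĉ : ℝ → F, ContDiff ℝ 1 ĉ ∧ (∀ s, ‖deriv ĉ s‖ ≤ L) ∧ ĉ t₁ = c t₁ ∧ ĉ (t₂ + η) = c t₂ ∧ ∀ s, ‖ĉ s - c (max t₁ (min s t₂))‖ ≤ L * η :=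
  fun ht hL hc _ hη ↦ WindowPaths.exists_contDiff_shadow_of_lipschitzOn ht hL hc hη

end Summit.FinalStateConjecture.FinalStateConjecture.Theorems

end
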